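import Mathlib.NumberTheory.NumberField.Basic
import Literature.AlgebraicGeometry.Motives.FaltingsFinitenessI
import Literature.AlgebraicGeometry.Motives.FaltingsAbelianOfFinitenessIProofs
import Summits.Langlands.Langlands.Theses.PhantomRMYoshida
import HarnessLib

/-!
# Route PhantomRMYoshida — FaltingsFinitenessI (item stmt-Langlands-15084) ⟹ Faltings' Tate-module theorems over `ℚ`

What the named-fact gate `FaltingsFinitenessI` of route `PhantomRMYoshida` (item
stmt-Langlands-15084, Faltings' **Finiteness I over `ℚ`**:
`∀ A : AbelianVariety ℚ, ∃ (n : ℕ) (C : Fin n → AbelianVariety ℚ), ∀ B, IsIsogenous B A → ∃ i, Nonempty (B ≅ C i)`,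
Faltings 1983, §6, Satz 5–6 with Zarhin's trick; Milne, *Abelian Varieties* (2008), IV Thm. 1.1)
BUYS in-tree.  The item is verbatim the Literature fact
`AbelianVariety.finite_isoClasses_isogenous A` at `K = ℚ` (sibling file
`PhantomRMYoshidaFaltingsFinitenessI.lean`), and the tree derives the whole of Faltings 1983 §5
from that fact alone (`Literature/AlgebraicGeometry/Motives/FaltingsAbelianOfFinitenessIProofs.lean`:
quotients by finite stable subgroups, `End_K(A)` finitely generated with injective Tate map and the
semisimplicity of `End⁰_K(A)` over a perfect field are theorems there).  Instantiated at `ℚ`: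

* `faltingsTateModuleQ_of_faltingsFinitenessI` — the item implies the sibling gate
  `FaltingsTateModuleQ` (item stmt-Langlands-15085) VERBATIM: for every prime `p` and every
  `B : AbelianVariety ℚ`, (i) the Tate map `ℤ_p ⊗ End_ℚ(B) → End_{Γ_ℚ}(T_p B)`
  (`AbelianVariety.faltingsTateMap B B p`) is bijective — §5 Satz 4, from Finiteness I for
  `B ⊞ B` — and (ii) `V_p B` (`AbelianVariety.rationalTateRep B p`) is a semisimple
  `ℚ_p[Γ_ℚ]`-module — §5 Satz 3, from Finiteness I for `B`.  These two clauses are literally the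
  two global hypotheses of the landed conditional stub `stub_tateModuleIrreducible` of crux
  StableYoshidaCongruence (`Theorems/PhantomRMYoshidaStableYoshidaCongruenceTateModuleIrreducible.lean`);
* `faltings_tate_bijective_of_faltingsFinitenessI` — §5 Korollar 1 over `ℚ` for all pairs
  (the named fact `faltings_tate_bijective X Y p`);
* `isSemisimpleRepresentation_rationalTateRep_of_faltingsFinitenessI` — §5 Satz 3 over `ℚ` as the
  named fact `isSemisimpleRepresentation_rationalTateRep B p`;
* `isIsogenous_iff_nonempty_equiv_rationalTateRep_of_faltingsFinitenessI` — §5 Korollar 2,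
  (i) ⇔ (ii), over `ℚ` (the named fact `isIsogenous_iff_nonempty_equiv_rationalTateRep X Y p`).

The item's statement is spelled out verbatim in every signature (the route file, rev 8, does not
yet declare `FaltingsFinitenessI`); pure-proof file, no definitions.
-/

set_option linter.dupNamespace false -- as in the sibling Theorems files: `Summit.Langlands.Langlands` is the mandated namespace (summit = sub-problem)

noncomputable section

open CategoryTheory CategoryTheory.Limits
open Literature.AlgebraicGeometry.Motives
open Literature.AlgebraicGeometry.Motives.AbelianVariety

namespace Summit.Langlands.Langlands.Theorems.PhantomRMYoshida

/-- **Finiteness I over `ℚ` ⟹ Faltings' Tate-module theorems over `ℚ`** (item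
stmt-Langlands-15084 ⟹ item stmt-Langlands-15085 `FaltingsTateModuleQ`, verbatim): for every
prime `p` and every abelian variety `B/ℚ`, (i) the Tate map
`ℤ_p ⊗ End_ℚ(B) → End_{Γ_ℚ}(T_p B)` (`AbelianVariety.faltingsTateMap B B p`) is bijective —
Faltings 1983, §5, Satz 4, here from Finiteness I for `B ⊞ B`
(`faltings_tate_end_bijective_of_finite_isoClasses_isogenous`) — and (ii) `V_p B`
(`AbelianVariety.rationalTateRep B p`) is a semisimple `ℚ_p[Γ_ℚ]`-module — Satz 3, from
Finiteness I for `B` (`isSemisimpleRepresentation_rationalTateRep_of_finite_isoClasses_isogenous`).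
Every other input of Faltings' §5 is a theorem of the tree, so nothing but the item is assumed;
the fact's inner binder `∀ [NumberField ℚ]` is discharged by `Rat.numberField`. -/
theorem faltingsTateModuleQ_of_faltingsFinitenessI
    (hFin : ∀ A : AbelianVariety ℚ, ∃ (n : ℕ) (C : Fin n → AbelianVariety ℚ),
      ∀ B : AbelianVariety ℚ, IsIsogenous B A → ∃ i, Nonempty (B ≅ C i)) :
    (∀ (p : ℕ) [Fact p.Prime] (B : AbelianVariety ℚ),
        Function.Bijective (AbelianVariety.faltingsTateMap B B p)) ∧
      (∀ (p : ℕ) [Fact p.Prime] (B : AbelianVariety ℚ),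
        (AbelianVariety.rationalTateRep B p).IsSemisimpleRepresentation) := by
  have hfact : ∀ A : AbelianVariety ℚ, finite_isoClasses_isogenous A := fun A _ ↦ hFin A
  refine ⟨fun p _ B ↦ ?_, fun p _ B ↦ ?_⟩
  · exact faltings_tate_end_bijective_of_finite_isoClasses_isogenous B p (hfact (B ⊞ B))
  · exact isSemisimpleRepresentation_rationalTateRep_of_finite_isoClasses_isogenous B p (hfact B)

/-- **Korollar 1 over `ℚ` from Finiteness I over `ℚ`**: for all abelian varieties `X`, `Y`
over `ℚ` and every prime `p`, the Tate map `ℤ_p ⊗ Hom_ℚ(X, Y) → Hom_{Γ_ℚ}(T_p X, T_p Y)` is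
bijective (the named fact `faltings_tate_bijective X Y p`, Faltings 1983, §5, Korollar 1), by
`faltings_tate_bijective_of_forall_finite_isoClasses_isogenous` (Finiteness I for
`(X ⊞ Y) ⊞ (X ⊞ Y)`). -/
theorem faltings_tate_bijective_of_faltingsFinitenessI
    (hFin : ∀ A : AbelianVariety ℚ, ∃ (n : ℕ) (C : Fin n → AbelianVariety ℚ),
      ∀ B : AbelianVariety ℚ, IsIsogenous B A → ∃ i, Nonempty (B ≅ C i))
    (X Y : AbelianVariety ℚ) (p : ℕ) [Fact p.Prime] : faltings_tate_bijective X Y p :=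
  faltings_tate_bijective_of_forall_finite_isoClasses_isogenous (K := ℚ) p (fun A _ ↦ hFin A) X Y

/-- **Satz 3 over `ℚ` from Finiteness I over `ℚ`**, in named-fact form: for every abelian variety
`B` over `ℚ` and every prime `p`, `V_p B` is a semisimple `ℚ_p[Γ_ℚ]`-module (the named fact
`isSemisimpleRepresentation_rationalTateRep B p`, Faltings 1983, §5, Satz 3), by
`isSemisimpleRepresentation_rationalTateRep_of_finite_isoClasses_isogenous`. -/
theorem isSemisimpleRepresentation_rationalTateRep_of_faltingsFinitenessI
    (hFin : ∀ A : AbelianVariety ℚ, ∃ (n : ℕ) (C : Fin n → AbelianVariety ℚ),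
      ∀ B : AbelianVariety ℚ, IsIsogenous B A → ∃ i, Nonempty (B ≅ C i))
    (B : AbelianVariety ℚ) (p : ℕ) [Fact p.Prime] :
    isSemisimpleRepresentation_rationalTateRep B p := by
  have hfact : ∀ A : AbelianVariety ℚ, finite_isoClasses_isogenous A := fun A _ ↦ hFin A
  intro hK
  exact isSemisimpleRepresentation_rationalTateRep_of_finite_isoClasses_isogenous B p (hfact B)

/-- **Korollar 2, (i) ⇔ (ii), over `ℚ` from Finiteness I over `ℚ`**: two abelian varieties
over `ℚ` are `ℚ`-isogenous iff their rational `p`-adic Tate modules are isomorphic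
`ℚ_p[Γ_ℚ]`-modules (the named fact `isIsogenous_iff_nonempty_equiv_rationalTateRep X Y p`,
Faltings 1983, §5, Korollar 2), by
`isIsogenous_iff_nonempty_equiv_rationalTateRep_of_forall_finite_isoClasses_isogenous`. -/
theorem isIsogenous_iff_nonempty_equiv_rationalTateRep_of_faltingsFinitenessI
    (hFin : ∀ A : AbelianVariety ℚ, ∃ (n : ℕ) (C : Fin n → AbelianVariety ℚ),
      ∀ B : AbelianVariety ℚ, IsIsogenous B A → ∃ i, Nonempty (B ≅ C i))
    (X Y : AbelianVariety ℚ) (p : ℕ) [Fact p.Prime] :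
    isIsogenous_iff_nonempty_equiv_rationalTateRep X Y p :=
  isIsogenous_iff_nonempty_equiv_rationalTateRep_of_forall_finite_isoClasses_isogenous X Y p
    (fun A _ ↦ hFin A)

/-! ## Route-level forms

Since rev 9 (2026-08-16) the route file `Theses/PhantomRMYoshida.lean` declares the two named-fact
gates `FaltingsFinitenessI` (item stmt-Langlands-15084) and `FaltingsTateModuleQ` (item
stmt-Langlands-15085) themselves; the theorems below restate the bridges against those decls
(appended 2026-08-16; everything above is unchanged). -/

/-- **The gate decl is the Literature fact at `K = ℚ`**: the route decl
`Summit.Langlands.Langlands.Theses.PhantomRMYoshida.FaltingsFinitenessI` (item stmt-Langlands-15084)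
unfolds to Finiteness I over `ℚ` and is equivalent to the named fact
`AbelianVariety.finite_isoClasses_isogenous A` for every `A : AbelianVariety ℚ` (both directions
`fun h A ↦ h A`, the fact's `∀ [NumberField ℚ]` binder being `Rat.numberField`). -/
theorem faltingsFinitenessI_iff :
    Summit.Langlands.Langlands.Theses.PhantomRMYoshida.FaltingsFinitenessI ↔
      ∀ A : AbelianVariety ℚ, finite_isoClasses_isogenous A := by
  unfold Summit.Langlands.Langlands.Theses.PhantomRMYoshida.FaltingsFinitenessI
  exact ⟨fun h A _ ↦ h A, fun h A ↦ h A⟩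

/-- **Conditional closer of item stmt-Langlands-15084**: the route decl `FaltingsFinitenessI`
follows from the Literature named fact `AbelianVariety.finite_isoClasses_isogenous` over `ℚ`
(Faltings 1983, §6, Satz 5–6 with Zarhin's trick; Milne, *Abelian Varieties* (2008), IV
Thm. 1.1), which the tree states without discharge — so this is a CONDITIONAL result: the item
closes the day `finite_isoClasses_isogenous` is proved, by this one line. -/
theorem faltingsFinitenessI_of_finite_isoClasses_isogenous
    (h : ∀ A : AbelianVariety ℚ, finite_isoClasses_isogenous A) :
    Summit.Langlands.Langlands.Theses.PhantomRMYoshida.FaltingsFinitenessI :=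
  faltingsFinitenessI_iff.2 h

/-- **Gate ⟹ gate: `FaltingsFinitenessI → FaltingsTateModuleQ`** (item stmt-Langlands-15084 ⟹
item stmt-Langlands-15085) at the level of the route decls: Finiteness I over `ℚ` gives, for
every prime `p` and every `B : AbelianVariety ℚ`, the bijectivity of the Tate map
`ℤ_p ⊗ End_ℚ(B) → End_{Γ_ℚ}(T_p B)` (Faltings 1983, §5, Satz 4) and the semisimplicity of `V_p B`
(Satz 3), by `faltingsTateModuleQ_of_faltingsFinitenessI`; so `FaltingsTateModuleQ` is the weaker
of the two gates and closes with `FaltingsFinitenessI`. -/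
theorem faltingsTateModuleQ_of_faltingsFinitenessI_decl :
    Summit.Langlands.Langlands.Theses.PhantomRMYoshida.FaltingsFinitenessI →
      Summit.Langlands.Langlands.Theses.PhantomRMYoshida.FaltingsTateModuleQ := by
  unfold Summit.Langlands.Langlands.Theses.PhantomRMYoshida.FaltingsFinitenessI
    Summit.Langlands.Langlands.Theses.PhantomRMYoshida.FaltingsTateModuleQ
  exact faltingsTateModuleQ_of_faltingsFinitenessI

end Summit.Langlands.Langlands.Theorems.PhantomRMYoshida

end
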